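import Summits.QuantumFields.YangMills.Theorems.AllWindowsColdBoxBulkMidLocalToGlobalSandwichC2

/-!
# Local-to-global Hessian sandwich — the `H₀`-metric statement with `C²` extension
# (crux idea `logconcave-core-extension` on ⟨stmt-QuantumFields-24006⟩, first lemma P2, C² input AND output, constant `C·r`)

`localToGlobalSandwich_posDef_C2`: as `localToGlobalSandwich_posDef` (sibling `…LocalToGlobalSandwichH0`) but concluding
`ContDiff ℝ 2 A` (from `localToGlobal_whitened_C2`; `A(x) = Ã(Px)` is `C²`).  With this the card's chain composes:
charted action `Φ_ω ∈ C²` + local sandwich ⇒ global `(1 ± C r)H₀`-sandwiched `C²` surrogate `A` ⇒ (26240 covariance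
comparison, `sandwichMeanNearMode`, `expMoment_le_of_sandwich_posDef` / Chernoff tails).

HONEST SCOPE.  Free-hands work of the LEAD seat of ⟨stmt-QuantumFields-24006⟩ (FCL lineage) on the first lemma of an
UN-TRIAGED crux idea card; pure calculus.  No stub of LINE-18, no crux, rung or summit is proved; the Yang–Mills mass
gap is NOT proved by any of this.
-/

noncomputable section

namespace Summit.QuantumFields.YangMills.Theorems.LocalToGlobalSandwich

open Real Filter Topology Set
open Summit.QuantumFields.YangMills.Theorems.SandwichVariancePinching

variable {n : ℕ}


open Summit.QuantumFields.YangMills.Cruxes.TransportCovarianceTransfer Matrix in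
/-- **LOCAL-TO-GLOBAL HESSIAN SANDWICH in the `H₀` metric with `C²` extension** (the card's `LocalToGlobalSandwich`
for `C²` input, `C²` output, constant `C·r`, `C` universal). [folklore] -/
theorem localToGlobalSandwich_posDef_C2 : ∃ C : ℝ, 0 ≤ C ∧
    ∀ (n : ℕ) (H₀ : Matrix (Fin n) (Fin n) ℝ), H₀.PosDef → ∀ (r ρ : ℝ), 0 ≤ r → 0 < ρ →
    ∀ (K U : Set (Fin n → ℝ)), K.Nonempty → IsOpen U →
      (∀ x ∈ K, ∀ y ∈ K, (x - y) ⬝ᵥ H₀.mulVec (x - y) ≤ ρ ^ 2) →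
      (∀ x ∈ K, ∀ v : Fin n → ℝ, v ⬝ᵥ H₀.mulVec v ≤ 4 * ρ ^ 2 → x + v ∈ U) →
      ∀ (Φ : (Fin n → ℝ) → ℝ), ContDiff ℝ 2 Φ →
        (∀ x h : Fin n → ℝ, x + h ∈ U → x - h ∈ U →
            (1 - r) * (h ⬝ᵥ H₀.mulVec h) ≤ Φ (x + h) + Φ (x - h) - 2 * Φ x ∧
              Φ (x + h) + Φ (x - h) - 2 * Φ x ≤ (1 + r) * (h ⬝ᵥ H₀.mulVec h)) →
        ∃ A : (Fin n → ℝ) → ℝ, ContDiff ℝ 2 A ∧ (∀ x ∈ K, A x = Φ x) ∧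
          ∀ x h : Fin n → ℝ,
            (1 - C * r) * (h ⬝ᵥ H₀.mulVec h) ≤ A (x + h) + A (x - h) - 2 * A x ∧
              A (x + h) + A (x - h) - 2 * A x ≤ (1 + C * r) * (h ⬝ᵥ H₀.mulVec h) := by
  obtain ⟨C, hC, hW⟩ := localToGlobal_whitened_C2
  refine ⟨C, hC, ?_⟩
  intro n H₀ hH₀ r ρ hr hρ K U hK hU hdiam hball Φ hΦ hsw
  obtain ⟨x₀, hx₀⟩ := hK
  obtain ⟨P, hPs, hP, hPP⟩ := exists_symm_sqrt hH₀
  -- the whitened potential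
  set Ψ : (Fin n → ℝ) → ℝ := fun y => Φ (P⁻¹ *ᵥ y) with hΨ
  have hΨ2 : ContDiff ℝ 2 Ψ := hΦ.comp (Matrix.mulVecLin P⁻¹).toContinuousLinearMap.contDiff
  -- Hessian sandwich of `Ψ` on the Euclidean ball around `P x₀`
  have hhess : ∀ yt : Fin n → ℝ, (yt - P *ᵥ x₀) ⬝ᵥ (yt - P *ᵥ x₀) ≤ 4 * ρ ^ 2 → ∀ u : Fin n → ℝ,
      (1 - r) * (u ⬝ᵥ u) ≤ fderiv ℝ (fderiv ℝ Ψ) yt u u ∧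
        fderiv ℝ (fderiv ℝ Ψ) yt u u ≤ (1 + r) * (u ⬝ᵥ u) := by
    intro yt hyt u
    set z : Fin n → ℝ := P⁻¹ *ᵥ yt with hz
    set v : Fin n → ℝ := P⁻¹ *ᵥ u with hv
    -- `z ∈ U`
    have hzU : z ∈ U := by
      have e : z = x₀ + P⁻¹ *ᵥ (yt - P *ᵥ x₀) := by
        rw [Matrix.mulVec_sub, inv_mulVec_mulVec hP, hz]; abel
      rw [e]
      refine hball x₀ hx₀ _ ?_
      rw [quadForm_inv_mulVec hPs hP hPP]
      exact hyt
    -- for small `s`, `z ± s•v ∈ U`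
    have hc1 : Continuous fun s : ℝ => z + s • v := continuous_const.add (continuous_id.smul continuous_const)
    have hc2 : Continuous fun s : ℝ => z - s • v := continuous_const.sub (continuous_id.smul continuous_const)
    have hU1 : ∀ᶠ s in 𝓝 (0:ℝ), z + s • v ∈ U :=
      hc1.continuousAt.eventually_mem (hU.mem_nhds (by simpa using hzU))
    have hU2 : ∀ᶠ s in 𝓝 (0:ℝ), z - s • v ∈ U :=
      hc2.continuousAt.eventually_mem (hU.mem_nhds (by simpa using hzU))
    -- second differences of `Ψ` at `yt` along `u` are those of `Φ` at `z` along `s•v`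
    have hident : ∀ s : ℝ, Ψ (yt + s • u) + Ψ (yt - s • u) - 2 * Ψ yt =
        Φ (z + s • v) + Φ (z - s • v) - 2 * Φ z := by
      intro s
      simp only [hΨ, hz, hv, Matrix.mulVec_add, Matrix.mulVec_sub, Matrix.mulVec_smul]
    have hquad : ∀ s : ℝ, (s • v) ⬝ᵥ H₀.mulVec (s • v) = s ^ 2 * (u ⬝ᵥ u) := by
      intro s
      rw [quadForm_eq_mulVec_sq hPs hPP, Matrix.mulVec_smul, hv, mulVec_inv_mulVec hP,
        smul_dotProduct, dotProduct_smul, smul_eq_mul, smul_eq_mul]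
      ring
    have hev : ∀ᶠ s in 𝓝 (0:ℝ),
        (1 - r) * (s ^ 2 * (u ⬝ᵥ u)) ≤ Ψ (yt + s • u) + Ψ (yt - s • u) - 2 * Ψ yt ∧
          Ψ (yt + s • u) + Ψ (yt - s • u) - 2 * Ψ yt ≤ (1 + r) * (s ^ 2 * (u ⬝ᵥ u)) := by
      filter_upwards [hU1, hU2] with s hs1 hs2
      have key := hsw z (s • v) hs1 hs2
      rw [hquad s] at key
      rw [hident s]
      exact key
    exact ⟨le_fderiv_fderiv_of_le_secondDiff_nhds hΨ2 yt u (hev.mono fun s hs => hs.1),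
      fderiv_fderiv_le_of_secondDiff_le_nhds hΨ2 yt u (hev.mono fun s hs => hs.2)⟩
  obtain ⟨At, hAtc, hAteq, hAtsw⟩ := hW n Ψ hΨ2 r ρ hr hρ (P *ᵥ x₀)
    (fun yt hyt u => (hhess yt hyt u).2) (fun yt hyt u => (hhess yt hyt u).1)
  refine ⟨fun x => At (P *ᵥ x), hAtc.comp (Matrix.mulVecLin P).toContinuousLinearMap.contDiff, ?_, ?_⟩
  · intro x hx
    have h1 : (P *ᵥ x - P *ᵥ x₀) ⬝ᵥ (P *ᵥ x - P *ᵥ x₀) ≤ ρ ^ 2 := by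
      rw [← Matrix.mulVec_sub, ← quadForm_eq_mulVec_sq hPs hPP]
      exact hdiam x hx x₀ hx₀
    show At (P *ᵥ x) = Φ x
    rw [hAteq _ h1]
    simp only [hΨ]
    rw [inv_mulVec_mulVec hP]
  · intro x h
    have key := hAtsw (P *ᵥ x) (P *ᵥ h)
    rw [← Matrix.mulVec_add, ← Matrix.mulVec_sub, ← quadForm_eq_mulVec_sq hPs hPP] at key
    exact key

end Summit.QuantumFields.YangMills.Theorems.LocalToGlobalSandwich

end
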